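import Summits.ABC.StewartYu.PadicG3ParB
import Summits.ABC.StewartYu.RecordGeneric
import Summits.ABC.StewartYu.RecordByName
import HarnessLib

/-!
# Cell abc-stewartyu, Gen-3 record v1 (WP-M3.R, m ≥ 1 branch): `RecordOdd` BY NAME for `PadicG3Par` at EVERY END
# datum of the frame — in particular at the frame's END range `⌊2ⁿ·X_Ŝ/(2(n+1))⌋` (even points only)

`Summits/ABC/StewartYu/RecordByName1.lean` — cell `abc-stewartyu` (HOME `run/shared/lean/pub/abc-stewartyu/`),
route `PadicPrimesKummerThird`, crux `Y07Odd` (stmt-ABC-19658), registered stub `stub_endRecord1` (record half,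
`1 ≤ m`); seat lp-1 (g3).  Theorems only.

The v1 record of record `PadicG3Par.recordOdd` (`RecordByName`, p488553) sits at the END datum
`(P.D₀, P.S₀N, P.Xfin, P.D)` with `P.Xfin = 2ⁿ·X_Ŝ/(n+1)`; the odd frame reads its final system at EVEN points
only, i.e. at the range `X_f := ⌊2ⁿ·X_Ŝ/(2(n+1))⌋ = ⌊P.Xfin/2⌋` (p2's `XfinOS P.sched1`, `PadicG3SchedInst`
p494136).  Here: the v1 instance of the record-agnostic capstone `RecordExitsNumeric.recordOdd_of_facts`
(`RecordGeneric`, p490748) with `(L, X, ρ, K, c, T) := (P.L, P.X, N_q L/2^Ŝ, P.K, C_bⁿ, 2^{Ŝ−1})` and the END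
datum FREE in the ranges `1 ≤ D₀ ≤ P.D₀`, `P.S₀N ≤ S₀`, `2^{Ŝ−1}·X ≤ 2·X_f`, `1 ≤ Dⱼ ≤ P.D j` (`recordOdd1`),
and the range fact `2^{Ŝ−1}·X ≤ 2·⌊2ⁿ·X_Ŝ/(2(n+1))⌋` for `n ≥ 2` (`X_Ŝ ≥ (31/34)·2^{Ŝ−1}·X`, `2ⁿ ≥ 4(n+1)/3`),
whence `recordOdd1_end : RecordOdd (256^·) p n P.A P.Amax P.W P.D₀ P.S₀N ⌊2ⁿ·X_Ŝ/(2(n+1))⌋ P.D`.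

Instantiation convention (STATUS lp-1 2026-08-27T00:58:15Z): `K ≤ N_q ≤ 2ⁿ·K` (the frame sets `N_q := K`),
`½ ≤ θ₀`, `Amax ≤ 2ⁿ·Ω`, `1 ≤ Aⱼ`.

References: Yu. V. Nesterenko, LNM 1819 (2003), §5.2 (5.12)–(5.22), Lemmas 5.3–5.4.
-/

noncomputable section

open Finset Real Nat

namespace Summit.ABC.StewartYu

namespace PadicG3Par

open Summit.ABC.StewartYu.RecordExitsNumeric
open Summit.ABC.StewartYu.GenThreeFrameSpecOdd (RecordOdd)

variable {n : ℕ} (P : PadicG3Par n)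

/-! ### The v1 record at every END datum -/

/-- **`RecordOdd (fun m => 256^m) p n P.A P.Amax P.W D₀ S₀ X_f D` for the v1 family `PadicG3Par`** at every END
datum `1 ≤ D₀ ≤ P.D₀`, `P.S₀N ≤ S₀`, `2^{Ŝ−1}·X ≤ 2·X_f`, `1 ≤ Dⱼ ≤ P.D j`, under the instantiation convention.
[cite: Nesterenko2003, §5.2 (5.12)–(5.22)] -/
theorem recordOdd1 (hKNq : P.K ≤ P.Nq) (hNqK : P.Nq ≤ 2 ^ n * P.K) (hθ : (1 / 2 : ℝ) ≤ P.θ₀)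
    (hAmax : P.Amax ≤ 2 ^ n * P.Ω) (hA1 : ∀ j, 1 ≤ P.A j) (p : ℕ)
    {D₀ S₀ Xf : ℕ} {D : Fin n → ℕ} (hD₀1 : 1 ≤ D₀) (hD₀ : D₀ ≤ P.D₀) (hS₀ : P.S₀N ≤ S₀)
    (hXf : 2 ^ (P.Sdepth - 1) * P.X ≤ 2 * Xf) (hD1 : ∀ j, 1 ≤ D j) (hD : ∀ j, D j ≤ P.D j) :
    RecordOdd (fun m => (256 : ℝ) ^ m) p n P.A P.Amax P.W D₀ S₀ Xf D := by
  have hK1 : (1 : ℝ) ≤ P.K := by exact_mod_cast P.one_le_K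
  have hΩ := P.Ω_pos
  have hCb64 := sixtyfour_le_Cb
  have hCb0 : (0 : ℝ) ≤ Cb := by linarith
  have hL0 : (0 : ℝ) ≤ P.L := by positivity
  have hSd : n + 24 ≤ P.Sdepth := by unfold Sdepth; omega
  -- the range scale `T = 2^{Ŝ-1}` and the range facts
  have hKT : (2 : ℝ) ^ (n + 22) * P.K < ((2 ^ (P.Sdepth - 1) : ℕ) : ℝ) := by
    exact_mod_cast P.two_pow_mul_K_lt hKNq
  have h23 : (2 : ℝ) ^ (n + 23) ≤ ((2 ^ (P.Sdepth - 1) : ℕ) : ℝ) := by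
    exact_mod_cast P.two_pow_le_two_pow_Sdepth_pred
  have hXf2 : 2 ^ (P.Sdepth - 1) * P.X < 2 * Xf + 1 := by omega
  have hxfT : ((2 ^ (P.Sdepth - 1) : ℕ) : ℝ) * (P.X : ℝ) < 2 * (Xf : ℝ) + 1 := by exact_mod_cast hXf2
  have hXf1 : 2 ^ (n + 22) * P.X ≤ Xf := by
    have e : 2 ^ (P.Sdepth - 1) = 2 ^ (P.Sdepth - 2) * 2 := by
      rw [← pow_succ]; congr 1; omega
    have h1 : 2 ^ (n + 22) ≤ 2 ^ (P.Sdepth - 2) := Nat.pow_le_pow_right (by norm_num) (by omega)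
    have h2 : 2 ^ (n + 22) * P.X ≤ 2 ^ (P.Sdepth - 2) * P.X := Nat.mul_le_mul_right _ h1
    have h3 : 2 * (2 ^ (P.Sdepth - 2) * P.X) ≤ 2 * Xf := by
      calc 2 * (2 ^ (P.Sdepth - 2) * P.X) = 2 ^ (P.Sdepth - 2) * 2 * P.X := by ring
        _ = 2 ^ (P.Sdepth - 1) * P.X := by rw [e]
        _ ≤ 2 * Xf := hXf
    omega
  -- the END degree scale `ρ = N_q L/2^Ŝ`
  have hρ1 := P.one_le_rho
  have hρlt := P.rho_lt
  have hDρ : ∀ j, (D j : ℝ) ≤ (P.Nq : ℝ) * P.L / 2 ^ P.Sdepth / P.A j + 1 := by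
    intro j
    have h1 : (D j : ℝ) ≤ P.D j := by exact_mod_cast hD j
    linarith [P.D_le_rho_div j]
  -- the box of clause (C) and `L = O(KΩ)`
  have hΛL : (P.Nq : ℝ) * P.L / 2 ^ P.Sdepth + P.Amax ≤
      (((2 : ℝ) ^ (n + 23))⁻¹ + 2 ^ n / (24 * Cb ^ n)) * P.L := by
    have h := P.rho_add_Amax_le hAmax
    have e : (((2 : ℝ) ^ (n + 23))⁻¹ + 2 ^ n / (24 * Cb ^ n)) * P.L =
        ((2 : ℝ) ^ (n + 23))⁻¹ * P.L + 2 ^ n / (24 * Cb ^ n) * P.L := by ring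
    rw [e]; exact h
  have hLKΩ : (P.L : ℝ) ≤ (264 * Cb ^ n + 2 ^ (2 * n + 26)) * P.K * ∏ j, P.A j :=
    P.L_le_KΩ hθ hNqK hAmax hA1
  -- exit B scalars
  have hc87 : Cb ^ n ≤ (87 : ℝ) ^ n := pow_le_pow_left₀ hCb0 Cb_le n
  have hc0 : (0 : ℝ) ≤ Cb ^ n := by positivity
  have h3L : (3 / 2 : ℝ) * (n + 1) * P.L ≤ P.X * (Cb ^ n * (∏ j, P.A j) * P.K) := P.three_halves_mul_L_le
  have hD₀8 : (D₀ : ℝ) ≤ 8 * P.X * (Cb ^ n * (∏ j, P.A j) * P.K) := by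
    have h1 : (D₀ : ℝ) ≤ P.D₀ := by exact_mod_cast hD₀
    exact h1.trans P.D₀_le_eight
  have hD₀q : (D₀ : ℝ) ≤ (P.X : ℝ) * P.L / 4 + 2 := by
    have h1 : (D₀ : ℝ) ≤ P.D₀ := by exact_mod_cast hD₀
    exact h1.trans P.D₀_le
  have hS : 16 * (n + 1) * P.L < (S₀ + 1) * (n + 2) ^ 4 :=
    lt_of_lt_of_le P.M_lt_S₀N_succ_mul (Nat.mul_le_mul_right _ (by omega))
  exact recordOdd_of_facts P.hn hA1 P.hAmax P.hAmax1 P.hW p (pow256_admissible n).1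
    (pow256_admissible n).2 P.one_le_X P.two_pow_le_L hD₀1 hD₀q hXf1 hS hD1 hDρ hρ1 hρlt hK1 hc0 hc87
    h3L hD₀8 h23 hxfT hKT hΛL hLKΩ

/-! ### The frame's END range `⌊2ⁿ·X_Ŝ/(2(n+1))⌋` -/

/-- **`34·X_Ŝ ≥ 31·2^{Ŝ−1}·X`** (`X_s (T_s+1) ≥ (31/8) X L`, `2^Ŝ (T_Ŝ + 1) ≤ 8L + 2^Ŝ ≤ (17/2) L`).
[cite: Nesterenko2003, §5.2 (5.12)] -/
theorem Xs_Sdepth_ge : 31 * (2 ^ (P.Sdepth - 1) * P.X) ≤ 34 * P.Xs P.Sdepth := by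
  have h1 := P.Xs_mul_ge' P.Sdepth
  have h2 : ((2 ^ P.Sdepth * P.T P.Sdepth : ℕ) : ℝ) ≤ ((8 * P.L : ℕ) : ℝ) := by
    exact_mod_cast P.two_pow_mul_T_le P.Sdepth
  have h3 : ((2 * 2 ^ P.Sdepth : ℕ) : ℝ) ≤ (P.L : ℝ) := by exact_mod_cast P.two_mul_two_pow_Sdepth_le_L
  push_cast at h2 h3
  have hSd : 1 ≤ P.Sdepth := by unfold Sdepth; omega
  obtain ⟨k, hk⟩ : ∃ k, P.Sdepth = k + 1 := ⟨P.Sdepth - 1, by omega⟩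
  rw [hk] at h1 h2 h3 ⊢
  simp only [Nat.add_sub_cancel]
  rw [pow_succ] at h2 h3
  have hX : (0 : ℝ) ≤ P.X := by positivity
  have hXs : (0 : ℝ) ≤ P.Xs (k + 1) := by positivity
  have h2k : (0 : ℝ) < 2 ^ k := by positivity
  -- `Xs·(17/2)L ≥ Xs·(T+1)·2^{k+1} ≥ (31/8) X L 2^{k+1}`
  have h4 : (P.Xs (k + 1) : ℝ) * ((P.T (k + 1) : ℝ) + 1) * (2 ^ k * 2) ≤ P.Xs (k + 1) * ((17 / 2) * P.L) := by
    have h5 : ((P.T (k + 1) : ℝ) + 1) * (2 ^ k * 2) ≤ (17 / 2) * P.L := by nlinarith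
    calc (P.Xs (k + 1) : ℝ) * ((P.T (k + 1) : ℝ) + 1) * (2 ^ k * 2)
        = P.Xs (k + 1) * (((P.T (k + 1) : ℝ) + 1) * (2 ^ k * 2)) := by ring
      _ ≤ P.Xs (k + 1) * ((17 / 2) * P.L) := mul_le_mul_of_nonneg_left h5 hXs
  have h6 : (31 / 8 : ℝ) * P.X * P.L * (2 ^ k * 2) ≤ P.Xs (k + 1) * ((17 / 2) * P.L) :=
    le_trans (mul_le_mul_of_nonneg_right h1 (by positivity)) h4
  have hL : (0 : ℝ) < P.L := by linarith [P.one_le_L]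
  have h7 : (31 : ℝ) * (2 ^ k * P.X) ≤ 34 * P.Xs (k + 1) := by
    have h8 : ((31 : ℝ) * (2 ^ k * P.X)) * P.L ≤ (34 * P.Xs (k + 1)) * P.L := by nlinarith
    exact le_of_mul_le_mul_right h8 hL
  exact_mod_cast h7

/-- `4(n+1) ≤ 3·2ⁿ` for `n ≥ 2`. [folklore] -/
theorem four_mul_succ_le_three_mul_two_pow {n : ℕ} (hn : 2 ≤ n) : 4 * (n + 1) ≤ 3 * 2 ^ n := by
  obtain ⟨k, hk⟩ : ∃ k, n = k + 2 := ⟨n - 2, by omega⟩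
  subst hk
  have h1 : k < 2 ^ k := Nat.lt_two_pow_self
  have e : 2 ^ (k + 2) = 4 * 2 ^ k := by rw [pow_add]; ring
  rw [e]; omega

/-- **`2^{Ŝ−1}·X ≤ 2·⌊2ⁿ·X_Ŝ/(2(n+1))⌋` for `n ≥ 2`** (the frame's END range condition of `recordOdd1`).
[cite: Nesterenko2003, §5.2 (5.12)] -/
theorem two_pow_mul_X_le_two_mul_XfinO (hn : 2 ≤ n) :
    2 ^ (P.Sdepth - 1) * P.X ≤ 2 * (2 ^ n * P.Xs P.Sdepth / (2 * (n + 1))) := by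
  have h1 := P.Xs_Sdepth_ge
  have h2 := four_mul_succ_le_three_mul_two_pow hn
  have hY : 10 ≤ 2 ^ (P.Sdepth - 1) * P.X := by
    have h3 : 2 ^ 4 ≤ 2 ^ (P.Sdepth - 1) := Nat.pow_le_pow_right (by norm_num) (by unfold Sdepth; omega)
    have h4 := P.one_le_X
    calc 10 ≤ 2 ^ 4 * 1 := by norm_num
      _ ≤ 2 ^ (P.Sdepth - 1) * P.X := Nat.mul_le_mul h3 h4
  generalize 2 ^ (P.Sdepth - 1) * P.X = Y at h1 hY ⊢
  generalize P.Xs P.Sdepth = Z at h1 ⊢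
  have h5 : 2 ^ n * Z < 2 ^ n * Z / (2 * (n + 1)) * (2 * (n + 1)) + 2 * (n + 1) :=
    Nat.lt_div_mul_add (by positivity)
  generalize 2 ^ n * Z / (2 * (n + 1)) = q at h5 ⊢
  -- `3·2ⁿ·Z ≥ 4(n+1)·Z`, `34 Z ≥ 31 Y`: `(n+1)·(2q + 2) > 2ⁿ Z ≥ (4/3)(n+1) Z ≥ (4/3)(31/34)(n+1) Y`
  have h6 : 4 * (n + 1) * Z ≤ 3 * 2 ^ n * Z := Nat.mul_le_mul_right Z h2
  by_contra hcon
  have hlt : 2 * q + 1 ≤ Y := by omega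
  -- multiply by `102 (n+1)`: `102(n+1)(2q+1) ≤ 102(n+1) Y`, and `102·2ⁿZ < 102(n+1)(2q+2)`
  have h7 : 102 * (n + 1) * (2 * q + 1) ≤ 102 * (n + 1) * Y := Nat.mul_le_mul_left _ hlt
  have h8 : 3 * (2 ^ n * Z) < 3 * (q * (2 * (n + 1)) + 2 * (n + 1)) := by omega
  -- `4(n+1)Z·34 ≤ 3·2ⁿ Z·34` and `31·Y·4(n+1) ≤ 34 Z·4(n+1)`
  have h9 : 31 * Y * (4 * (n + 1)) ≤ 34 * Z * (4 * (n + 1)) := Nat.mul_le_mul_right _ h1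
  nlinarith

/-- `2·((n+1)·⌊2ⁿ·X_Ŝ/(2(n+1))⌋) ≤ 2ⁿ·X_Ŝ` (the frame's even-points constraint, v1). [folklore] -/
theorem two_mul_XfinO1_le : 2 * ((n + 1) * (2 ^ n * P.Xs P.Sdepth / (2 * (n + 1)))) ≤ 2 ^ n * P.Xs P.Sdepth := by
  rw [← mul_assoc, mul_comm]
  exact Nat.div_mul_le_self _ _

/-- `1 ≤ P.D₀`. [folklore] -/
theorem one_le_D₀ : 1 ≤ P.D₀ := by unfold D₀; omega

/-- **The v1 record at the frame's END slots** (`n ≥ 2`):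
`RecordOdd (256^·) p n P.A P.Amax P.W P.D₀ P.S₀N ⌊2ⁿ·X_Ŝ/(2(n+1))⌋ P.D`. [cite: Nesterenko2003, §5.2 (5.12)–(5.22)] -/
theorem recordOdd1_end (hn : 2 ≤ n) (hKNq : P.K ≤ P.Nq) (hNqK : P.Nq ≤ 2 ^ n * P.K)
    (hθ : (1 / 2 : ℝ) ≤ P.θ₀) (hAmax : P.Amax ≤ 2 ^ n * P.Ω) (hA1 : ∀ j, 1 ≤ P.A j) (p : ℕ) :
    RecordOdd (fun m => (256 : ℝ) ^ m) p n P.A P.Amax P.W P.D₀ P.S₀N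
      (2 ^ n * P.Xs P.Sdepth / (2 * (n + 1))) P.D :=
  P.recordOdd1 hKNq hNqK hθ hAmax hA1 p P.one_le_D₀ le_rfl le_rfl (P.two_pow_mul_X_le_two_mul_XfinO hn)
    P.one_le_D (fun _ => le_rfl)

end PadicG3Par

end Summit.ABC.StewartYu

end
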